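import Literature.Probability.LatticeModels.SharpLengthDCP
import Literature.Probability.LatticeModels.SharpnessSubcritical
import Literature.Probability.LatticeModels.CriticalTwoPointBounds
import HarnessLib

/-!
# Proof of the near-critical plateau upper bound (Duminil-Copin–Panis 2025, eq. (1.4))

Topic `Literature/Probability/LatticeModels`; family `crit-ising`. Sibling proof file of
`SharpLengthDCP.lean`: it discharges the named fact
`Literature.Probability.LatticeModels.dcp_nearCritical_upper` (`dcp_nearCritical_upper_holds`),
i.e. eq. (1.4) of H. Duminil-Copin, R. Panis, *New lower bounds for the (near) critical Ising and
φ⁴ models' two-point functions*, CMP 406 (2025), arXiv:2404.05700 (held, p. 4): "With this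
definition at hand, the Simon–Lieb inequality together with the infrared bound (1.3) yield the
following result: there exist `c, C > 0` such that, if `β ≤ β_c` and `x ∈ ℤ^d ∖ {0}`,
`⟨τ₀τ_x⟩_β ≤ C (1/(|x| ∧ L(β)))^{d-2} exp(−c|x|/L(β))`."

## The printed argument and how it is followed here

The source gives exactly the one-line proof quoted above; we spell it out with the tree's
versions of its two inputs.

1. **Infrared bound** (1.3): `⟨τ₀τ_x⟩_β ≤ C₀/|x|^{d-2}` for all `β ≤ β_c`, `x ≠ 0`, `d ≥ 3`. In the
   tree this is the discharged fact `twoPointFree_criticalBeta_upper` at `β = β_c`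
   (`twoPointFree_criticalBeta_upper_holds`, module `CriticalTwoPointBounds`: Fröhlich–Simon–Spencer
   + Messager–Miracle-Solé, Duminil-Copin 2019, Thm. 4.8), transported to `β ≤ β_c` by Griffiths'
   monotonicity in `β` (`twoPointFree_mono_beta`, GKS II) — `twoPointFree_le_of_le_criticalBeta`.
2. **Simon–Lieb step.** If `L(β) = ℓ < ∞` there is a witness `S ∋ 0`, `diam S ≤ 2ℓ`,
   `φ_β(S) < 1/2` at scale exactly `ℓ` (`isSharpLengthWitness_of_sharpLength_eq`), hence
   `S ⊆ Λ_{2ℓ}`; since `tanh β ≤ β`, Duminil-Copin–Tassion's functional satisfies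
   `φ^{DCT}_β(S) ≤ φ_β(S) < 1/2` (`dctIsingPhi_le_dcpPhi`). The modified Simon (= Simon–Lieb with
   `tanh`) inequality for the free state (Duminil-Copin–Tassion 2016, Lemma 2.7; the tree's
   `isingTwoPoint_free_le_modifiedSimon`, here passed to `Λ ↑ ℤ^d` for `β ≥ 0`,
   `twoPointFree_le_dct_sum_of_nonneg`) is iterated as in DCT 2016, §2.5, but stopped at distance
   `ℓ` from the target, where the infrared bound `≤ C₀ ℓ^{2-d}` takes over
   (`twoPointFree_le_dctIsingPhi_pow_mul`): for `‖x‖ ≥ k(2ℓ+1) + ℓ`,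
   `⟨τ₀τ_x⟩_β ≤ φ^{DCT}_β(S)^k · C₀ ℓ^{2-d} ≤ 2^{-k} C₀ ℓ^{2-d}`.
3. **Bookkeeping.** With `k = ⌊(‖x‖ - ℓ)/(2ℓ+1)⌋` one has `‖x‖ ≤ 3ℓ(k+2)`, so
   `2^{-k} ≤ 4 exp(-(log 2/3) ‖x‖/ℓ)`; for `‖x‖ ≤ ℓ` (and for `L(β) = ∞`) the infrared bound alone
   suffices since `exp(-(log 2/3)‖x‖/ℓ) ≥ 1/4`. Constants: `c = (log 2)/3`, `C = 4C₀`.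

No new definitions and no new named facts (D-0026): every intermediate statement is proved here.

## References

* H. Duminil-Copin, R. Panis, CMP 406 (2025), arXiv:2404.05700 [DuminilCopinPanis2025LowerBounds]:
  Def. 1.1 and eq. (1.4) (p. 4 of the held arXiv text).
* H. Duminil-Copin, V. Tassion, CMP 343 (2016) 725 [DuminilCopinTassionCMP2016]: Lemma 2.7 and
  §2.5 (arXiv:1502.03050 numbering).
* H. Duminil-Copin, *Lectures on the Ising and Potts models on the hypercubic lattice* (2019)
  [DuminilCopin2019]: Thm. 4.8 (infrared bound in `x`-space).
* S. Friedli, Y. Velenik, *Statistical Mechanics of Lattice Systems* (CUP 2017)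
  [FriedliVelenik2017]: Exercise 3.9, Thm. 3.20 (Griffiths' monotonicity).
-/

noncomputable section

open Finset Filter
open _root_.Topology _root_.MeasureTheory

namespace Literature.Probability.LatticeModels

variable {d : ℕ}

/-! ### Elementary real-analysis bookkeeping -/

/-- `tanh y ≤ y` for `y ≥ 0` (the function `t cosh t - sinh t` vanishes at `0` and has
derivative `t sinh t ≥ 0` on `[0, ∞)`). [folklore] -/
private theorem tanh_le_self_of_nonneg {y : ℝ} (hy : 0 ≤ y) : Real.tanh y ≤ y := by
  rw [Real.tanh_eq_sinh_div_cosh, div_le_iff₀ (Real.cosh_pos y)]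
  have hder : ∀ t : ℝ,
      HasDerivAt (fun t => t * Real.cosh t - Real.sinh t) (t * Real.sinh t) t := by
    intro t
    have h1 : HasDerivAt (fun t => t * Real.cosh t - Real.sinh t)
        (1 * Real.cosh t + t * Real.sinh t - Real.cosh t) t :=
      ((hasDerivAt_id' t).mul (Real.hasDerivAt_cosh t)).sub (Real.hasDerivAt_sinh t)
    exact h1.congr_deriv (by ring)
  have hmono : MonotoneOn (fun t => t * Real.cosh t - Real.sinh t) (Set.Ici 0) := by
    refine monotoneOn_of_deriv_nonneg (convex_Ici 0)
      (fun t _ => (hder t).continuousAt.continuousWithinAt)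
      (fun t _ => (hder t).differentiableAt.differentiableWithinAt) fun t ht => ?_
    rw [interior_Ici] at ht
    rw [(hder t).deriv]
    exact mul_nonneg (le_of_lt ht) (Real.sinh_nonneg_iff.2 (le_of_lt ht))
  have h := hmono (Set.self_mem_Ici) (Set.mem_Ici.2 hy) hy
  simp only [zero_mul, Real.sinh_zero, sub_zero] at h
  linarith

/-- `2^{-k} ≤ 4 e^{-s}` as soon as `s ≤ (k + 2) log 2` (both sides are exponentials:
`2^{-k} = e^{-k log 2}` and `4 = e^{2 log 2}`). [folklore] -/
private theorem half_pow_le_four_mul_exp_neg {k : ℕ} {s : ℝ} (hs : s ≤ (k + 2) * Real.log 2) :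
    (1 / 2 : ℝ) ^ k ≤ 4 * Real.exp (-s) := by
  have h2 : Real.exp (Real.log 2) = 2 := Real.exp_log (by norm_num)
  have hk : (1 / 2 : ℝ) ^ k = Real.exp (-(k * Real.log 2)) := by
    rw [Real.exp_neg, Real.exp_nat_mul, h2, one_div, inv_pow]
  have h4 : (4 : ℝ) = Real.exp (2 * Real.log 2) := by
    rw [two_mul, Real.exp_add, h2]; norm_num
  rw [hk, h4, ← Real.exp_add, Real.exp_le_exp]
  linarith

/-! ### The sharp length: extracting a witness at scale `L(β)` -/

/-- If `L(β) = ℓ < ∞` then `ℓ` itself is an admissible scale: the infimum of a nonempty set of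
natural numbers is attained (Duminil-Copin–Panis 2025, Def. 1.1). [cite: DuminilCopinPanis2025LowerBounds, Definition 1.1] -/
theorem isSharpLengthWitness_of_sharpLength_eq {β : ℝ} {ℓ : ℕ} (h : sharpLength d β = ℓ) :
    IsSharpLengthWitness d β ℓ := by
  classical
  by_cases hex : ∃ k, IsSharpLengthWitness d β k
  · have hk₀ : IsSharpLengthWitness d β (Nat.find hex) := Nat.find_spec hex
    have hmin : ∀ k, IsSharpLengthWitness d β k → Nat.find hex ≤ k :=
      fun k hk => Nat.find_min' hex hk
    have heq : sharpLength d β = (Nat.find hex : ℕ) :=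
      le_antisymm (sharpLength_le hk₀) (le_sharpLength_iff.2 hmin)
    rw [h] at heq
    have hℓ : ℓ = Nat.find hex := by exact_mod_cast heq
    rw [hℓ]
    exact hk₀
  · push Not at hex
    rw [sharpLength_eq_top hex] at h
    exact absurd h (ENat.top_ne_coe ℓ)

/-- A set `S ∋ 0` of sup-norm diameter `≤ 2ℓ` lies in the box `Λ_{2ℓ}`. [folklore] -/
theorem subset_box_of_diam_le {ℓ : ℕ} {S : Finset (Site d)} (h0 : (0 : Site d) ∈ S)
    (hdiam : ∀ x ∈ S, ∀ y ∈ S, ‖x - y‖ ≤ 2 * (ℓ : ℝ)) : S ⊆ box d (2 * ℓ) := by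
  intro x hx
  rw [mem_box_iff_supNorm_le]
  have h := hdiam x hx 0 h0
  rw [sub_zero, Site.norm_eq_supNorm] at h
  exact_mod_cast h

/-- **`φ^{DCT}_β(S) ≤ φ_β(S)`**: Duminil-Copin–Tassion's functional (with `tanh β`,
`dctIsingPhi`) is dominated by Duminil-Copin–Panis' `φ_β(S)` (with `β`, `dcpPhi`, Def. 1.1),
because `tanh β ≤ β` and finite-volume two-point functions are nonnegative (GKS I). [cite: DuminilCopinPanis2025LowerBounds, Definition 1.1] -/
theorem dctIsingPhi_le_dcpPhi
    (hgks : ∀ {Λ A : Finset (Site d)} {β h : ℝ} {bc : BoundaryCondition (Site d)},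
      gks_one (zdGraph d) (Λ := Λ) (A := A) (β := β) (h := h) (bc := bc))
    {β : ℝ} (hβ : 0 ≤ β) {S : Finset (Site d)} (h0 : (0 : Site d) ∈ S) :
    dctIsingPhi d β S ≤ dcpPhi d β S := by
  rw [dctIsingPhi_eq_sum_card_mul, dcpPhi, Finset.mul_sum]
  refine Finset.sum_le_sum fun x hx => ?_
  have hT : 0 ≤ isingTwoPoint (zdGraph d) S β 0 .free 0 x :=
    isingTwoPoint_free_nonneg hgks hβ h0 hx
  have hc : (0 : ℝ) ≤ #(((zdGraph d).neighborFinset x).filter (fun y => y ∉ S)) :=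
    Nat.cast_nonneg _
  calc (#(((zdGraph d).neighborFinset x).filter (fun y => y ∉ S)) : ℝ) *
        (Real.tanh β * isingTwoPoint (zdGraph d) S β 0 .free 0 x)
      ≤ #(((zdGraph d).neighborFinset x).filter (fun y => y ∉ S)) *
        (β * isingTwoPoint (zdGraph d) S β 0 .free 0 x) :=
        mul_le_mul_of_nonneg_left
          (mul_le_mul_of_nonneg_right (tanh_le_self_of_nonneg hβ) hT) hc
    _ = β * (#(((zdGraph d).neighborFinset x).filter (fun y => y ∉ S)) *
        isingTwoPoint (zdGraph d) S β 0 .free 0 x) := by ring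

/-! ### The infrared bound for `β ≤ β_c` -/

/-- **The infrared bound (1.3) below and at `β_c`** (Duminil-Copin–Panis 2025, eq. (1.3):
"there exists `C = C(d) > 0` such that for all `β ≤ β_c` and all `x ≠ 0`,
`⟨τ₀τ_x⟩_β ≤ C/|x|^{d-2}`"), for `d ≥ 3` and `0 ≤ β ≤ β_c`: the tree's discharged bound at `β_c`
(`twoPointFree_criticalBeta_upper_holds`, Duminil-Copin 2019, Thm. 4.8) and Griffiths'
monotonicity in `β` (`twoPointFree_mono_beta`). [cite: DuminilCopinPanis2025LowerBounds, eq. (1.3)] -/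
theorem twoPointFree_le_of_le_criticalBeta (hd : 3 ≤ d) :
    ∃ C₀ : ℝ, 0 < C₀ ∧ ∀ β : ℝ, 0 ≤ β → β ≤ criticalBeta d → ∀ x : Site d, x ≠ 0 →
      twoPointFree d β x ≤ C₀ * (1 / ‖x‖) ^ (d - 2) := by
  obtain ⟨C, hC⟩ := twoPointFree_criticalBeta_upper_holds (d := d) hd
  have hlim : hasBoxLimit_isingCorr_free d := hasBoxLimit_isingCorr_free_holds
  have hβmono : isingCorr_free_mono_beta (d := d) :=
    isingCorr_free_mono_beta_of_gks_two fun _ _ _ _ _ _ =>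
      GKSInequalities.gks_two_holds (zdGraph d)
  refine ⟨max C 1, lt_max_of_lt_right one_pos, fun β hβ hβc x hx => ?_⟩
  have hrpow : (‖x‖ : ℝ) ^ (-((d : ℝ) - 2)) = (1 / ‖x‖) ^ (d - 2) := by
    rw [Real.rpow_neg (norm_nonneg x), one_div, inv_pow]
    congr 1
    rw [show ((d : ℝ) - 2) = ((d - 2 : ℕ) : ℝ) by
      rw [Nat.cast_sub (by omega : 2 ≤ d)]; norm_num, Real.rpow_natCast]
  calc twoPointFree d β x ≤ twoPointFree d (criticalBeta d) x :=
        twoPointFree_mono_beta hβmono hlim hβ hβc x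
    _ ≤ C * ‖x‖ ^ (-((d : ℝ) - 2)) := hC x hx
    _ ≤ max C 1 * ‖x‖ ^ (-((d : ℝ) - 2)) :=
        mul_le_mul_of_nonneg_right (le_max_left _ _) (Real.rpow_nonneg (norm_nonneg x) _)
    _ = max C 1 * (1 / ‖x‖) ^ (d - 2) := by rw [hrpow]

/-! ### The modified Simon inequality for the free state (`β ≥ 0`) and its stopped iteration -/

/-- **The modified Simon inequality for the free state, `β ≥ 0`** (Duminil-Copin–Tassion 2016,
Lemma 2.7 with `Λ ↑ ℤ^d`): for finite `S ∋ 0` and `z ∉ S`,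
`⟨σ₀σ_z⟩^∅_β ≤ ∑_{x ∈ S} ∑_{y ∉ S, y ∼ x} tanh β · ⟨σ₀σ_x⟩^∅_{S;β,0} · ⟨σ₀σ_{z-y}⟩^∅_β`. This is
the tree's `twoPointFree_le_dct_sum` with its hypothesis `β > 0` relaxed to `β ≥ 0`, by feeding
the finite-volume theorem `isingTwoPoint_free_le_modifiedSimon` (valid for `β ≥ 0`) directly;
the proof is otherwise verbatim the tree's. [cite: DuminilCopinTassionCMP2016, Lemma 2.7 and its proof, §2.5 (arXiv:1502.03050 numbering)] -/
theorem twoPointFree_le_dct_sum_of_nonneg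
    (hgks : ∀ {Λ A : Finset (Site d)} {β h : ℝ} {bc : BoundaryCondition (Site d)},
      gks_one (zdGraph d) (Λ := Λ) (A := A) (β := β) (h := h) (bc := bc))
    (hmono : isingCorr_free_mono_volume (d := d)) (hlim : hasBoxLimit_isingCorr_free d)
    (htr : isingTwoPoint_free_translate (d := d)) {β : ℝ} (hβ : 0 ≤ β) {S : Finset (Site d)}
    (h0 : (0 : Site d) ∈ S) {z : Site d} (hz : z ∉ S) :
    twoPointFree d β z ≤
      ∑ x ∈ S, ∑ y ∈ ((zdGraph d).neighborFinset x).filter (fun y => y ∉ S),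
        Real.tanh β * isingTwoPoint (zdGraph d) S β 0 .free 0 x * twoPointFree d β (z - y) := by
  refine le_of_tendsto (tendsto_isingTwoPoint_free hlim hβ z) ?_
  filter_upwards [eventually_mem_box z, eventually_subset_box' S] with L hzL hSL
  refine (isingTwoPoint_free_le_modifiedSimon (zdGraph d) hβ hSL h0 hzL hz).trans
    (Finset.sum_le_sum fun x hx => ?_)
  have hcx : 0 ≤ Real.tanh β * isingTwoPoint (zdGraph d) S β 0 .free 0 x :=
    mul_nonneg (tanh_nonneg hβ) (isingTwoPoint_free_nonneg hgks hβ h0 hx)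
  calc ∑ y ∈ (box d L \ S).filter ((zdGraph d).Adj x),
        Real.tanh β * isingTwoPoint (zdGraph d) S β 0 .free 0 x *
          isingTwoPoint (zdGraph d) (box d L) β 0 .free y z
      ≤ ∑ y ∈ (box d L \ S).filter ((zdGraph d).Adj x),
          Real.tanh β * isingTwoPoint (zdGraph d) S β 0 .free 0 x * twoPointFree d β (z - y) := by
        refine Finset.sum_le_sum fun y hy => mul_le_mul_of_nonneg_left ?_ hcx
        have hyL : y ∈ box d L := (mem_sdiff.1 (mem_filter.1 hy).1).1
        exact isingTwoPoint_free_le_twoPointFree_sub hmono hlim htr hβ hyL hzL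
    _ ≤ ∑ y ∈ ((zdGraph d).neighborFinset x).filter (fun y => y ∉ S),
          Real.tanh β * isingTwoPoint (zdGraph d) S β 0 .free 0 x * twoPointFree d β (z - y) := by
        refine Finset.sum_le_sum_of_subset_of_nonneg ?_ fun y _ _ =>
          mul_nonneg hcx (twoPointFree_nonneg hlim hgks hβ _)
        intro y hy
        obtain ⟨hy1, hy2⟩ := Finset.mem_filter.1 hy
        exact Finset.mem_filter.2 ⟨(SimpleGraph.mem_neighborFinset _ _ _).2 hy2,
          (Finset.mem_sdiff.1 hy1).2⟩

/-- **Stopped iteration of the modified Simon inequality** (Duminil-Copin–Tassion 2016, §2.5,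
"iterating … this strategy", combined with an a-priori bound as in Duminil-Copin–Panis 2025,
eq. (1.4)): if `S ⊆ Λ_K`, `0 ∈ S`, `β ≥ 0`, and `⟨σ₀σ_z⟩^∅_β ≤ B` whenever `‖z‖_∞ ≥ R`, then
`⟨σ₀σ_z⟩^∅_β ≤ φ^{DCT}_β(S)^k · B` whenever `‖z‖_∞ ≥ k(K+1) + R` (each step costs a factor
`φ^{DCT}_β(S)` and moves the target by at most `K + 1` in sup norm). [cite: DuminilCopinTassionCMP2016, §2.5, proof of Thm. 2.1, third item (arXiv:1502.03050 numbering)] -/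
theorem twoPointFree_le_dctIsingPhi_pow_mul
    (hgks : ∀ {Λ A : Finset (Site d)} {β h : ℝ} {bc : BoundaryCondition (Site d)},
      gks_one (zdGraph d) (Λ := Λ) (A := A) (β := β) (h := h) (bc := bc))
    (hmono : isingCorr_free_mono_volume (d := d)) (hlim : hasBoxLimit_isingCorr_free d)
    (htr : isingTwoPoint_free_translate (d := d)) {β : ℝ} (hβ : 0 ≤ β) {S : Finset (Site d)}
    (h0 : (0 : Site d) ∈ S) {K : ℕ} (hSK : S ⊆ box d K) {R : ℕ} {B : ℝ}
    (hB : ∀ z : Site d, R ≤ Site.supNorm z → twoPointFree d β z ≤ B) (k : ℕ) :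
    ∀ z : Site d, k * (K + 1) + R ≤ Site.supNorm z →
      twoPointFree d β z ≤ dctIsingPhi d β S ^ k * B := by
  induction k with
  | zero =>
      intro z hz
      rw [pow_zero, one_mul]
      exact hB z (by omega)
  | succ k ih =>
      intro z hz
      rw [Nat.succ_mul] at hz
      have hzS : z ∉ S := by
        intro hzS
        have := mem_box_iff_supNorm_le.1 (hSK hzS)
        omega
      refine (twoPointFree_le_dct_sum_of_nonneg hgks hmono hlim htr hβ h0 hzS).trans ?_
      calc ∑ x ∈ S, ∑ y ∈ ((zdGraph d).neighborFinset x).filter (fun y => y ∉ S),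
            Real.tanh β * isingTwoPoint (zdGraph d) S β 0 .free 0 x * twoPointFree d β (z - y)
          ≤ ∑ x ∈ S, ∑ _y ∈ ((zdGraph d).neighborFinset x).filter (fun y => y ∉ S),
            Real.tanh β * isingTwoPoint (zdGraph d) S β 0 .free 0 x *
              (dctIsingPhi d β S ^ k * B) := by
            refine Finset.sum_le_sum fun x hx => Finset.sum_le_sum fun y hy => ?_
            refine mul_le_mul_of_nonneg_left (ih (z - y) ?_)
              (mul_nonneg (tanh_nonneg hβ) (isingTwoPoint_free_nonneg hgks hβ h0 hx))
            have hadj : (zdGraph d).Adj x y := by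
              simp only [mem_filter, SimpleGraph.mem_neighborFinset] at hy
              exact hy.1
            have hxK : Site.supNorm x ≤ K := mem_box_iff_supNorm_le.1 (hSK hx)
            have hyK := Site.supNorm_le_succ_of_adj hadj
            have htri := Site.supNorm_le_supNorm_sub_add z y
            omega
        _ = dctIsingPhi d β S * (dctIsingPhi d β S ^ k * B) := by
            rw [dctIsingPhi, Finset.sum_mul]
            refine Finset.sum_congr rfl fun x _ => ?_
            rw [Finset.sum_mul]
        _ = dctIsingPhi d β S ^ (k + 1) * B := by rw [pow_succ']; ring

/-! ### Eq. (1.4) -/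

/-- **Duminil-Copin–Panis 2025, eq. (1.4), proved**: for `d ≥ 3` there are `c, C > 0` with
`⟨τ₀τ_x⟩_β ≤ C (1/(|x| ∧ L(β)))^{d-2} exp(−c|x|/L(β))` for all `0 ≤ β ≤ β_c` and `x ≠ 0` — the
named fact `dcp_nearCritical_upper` holds, with `c = (log 2)/3` and `C = 4C₀`, `C₀` the
infrared-bound constant. Proof as printed ("the Simon–Lieb inequality together with the
infrared bound yield"): `twoPointFree_le_of_le_criticalBeta` for `|x| ≤ L(β)` and for
`L(β) = ∞`; for `|x| > L(β) = ℓ`, the stopped iteration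
`twoPointFree_le_dctIsingPhi_pow_mul` from the witness `S ⊆ Λ_{2ℓ}` with
`φ^{DCT}_β(S) ≤ φ_β(S) < 1/2`, `k = ⌊(|x| - ℓ)/(2ℓ+1)⌋` steps, and the infrared bound
`≤ C₀ ℓ^{2-d}` at the end. [cite: DuminilCopinPanis2025LowerBounds, eq. (1.4) (display after Definition 1.1)] -/
theorem dcp_nearCritical_upper_holds : dcp_nearCritical_upper (d := d) := by
  intro hd
  obtain ⟨C₀, hC₀, hIR⟩ := twoPointFree_le_of_le_criticalBeta (d := d) hd
  have hgks : ∀ {Λ A : Finset (Site d)} {β h : ℝ} {bc : BoundaryCondition (Site d)},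
      gks_one (zdGraph d) (Λ := Λ) (A := A) (β := β) (h := h) (bc := bc) :=
    GKSInequalities.gks_one_holds (zdGraph d)
  have hgks2 : ∀ (G' : SimpleGraph (Site d)) [G'.LocallyFinite] (Λ A B : Finset (Site d))
      (β h : ℝ) (bc : BoundaryCondition (Site d)),
      gks_two G' (Λ := Λ) (A := A) (B := B) (β := β) (h := h) (bc := bc) :=
    fun G' _ _ _ _ _ _ _ => GKSInequalities.gks_two_holds G'
  have hlim : hasBoxLimit_isingCorr_free d := hasBoxLimit_isingCorr_free_holds
  have hmono : isingCorr_free_mono_volume (d := d) := isingCorr_free_mono_volume_of_gks_two hgks2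
  have htr : isingTwoPoint_free_translate (d := d) := isingTwoPoint_free_translate_holds
  have hlog : 0 < Real.log 2 := Real.log_pos (by norm_num)
  refine ⟨Real.log 2 / 3, 4 * C₀, by positivity, by positivity, fun β hβ hβc x hx => ?_⟩
  -- `‖x‖ = n ≥ 1`
  set n : ℕ := Site.supNorm x with hn
  have hn1 : 1 ≤ n := Nat.one_le_iff_ne_zero.2 fun h => hx (Site.supNorm_eq_zero_iff.1 h)
  have hnorm : ‖x‖ = (n : ℝ) := Site.norm_eq_supNorm x
  have hP : 0 ≤ (1 / ‖x‖) ^ (d - 2) := by positivity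
  refine ⟨fun _ => ?_, fun ℓ hℓ => ?_⟩
  · -- `L(β) = ∞`: the infrared bound alone
    have h1 := hIR β hβ hβc x hx
    have h2 : 0 ≤ C₀ * (1 / ‖x‖) ^ (d - 2) := mul_nonneg hC₀.le hP
    linarith
  · -- `L(β) = ℓ < ∞`: a witness at scale `ℓ`
    obtain ⟨hℓ1, S, h0S, hdiam, hφS⟩ := isSharpLengthWitness_of_sharpLength_eq hℓ
    have hSK : S ⊆ box d (2 * ℓ) := subset_box_of_diam_le h0S hdiam
    have hφ : dctIsingPhi d β S < 1 / 2 := (dctIsingPhi_le_dcpPhi hgks hβ h0S).trans_lt hφS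
    have hφ0 : 0 ≤ dctIsingPhi d β S := dctIsingPhi_nonneg hgks hβ h0S
    have hℓpos : (0 : ℝ) < ℓ := by exact_mod_cast hℓ1
    by_cases hnℓ : n ≤ ℓ
    · -- `‖x‖ ≤ ℓ`: `|x| ∧ L(β) = |x|`, infrared bound and `exp(-c|x|/ℓ) ≥ exp(-c) ≥ 1/4`
      have hmin : min ‖x‖ (ℓ : ℝ) = ‖x‖ := min_eq_left (by rw [hnorm]; exact_mod_cast hnℓ)
      rw [hmin]
      have hs : Real.log 2 / 3 * ‖x‖ / ℓ ≤ (((0 : ℕ) : ℝ) + 2) * Real.log 2 := by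
        rw [Nat.cast_zero, zero_add]
        have h1 : ‖x‖ / ℓ ≤ 1 := by
          rw [div_le_one hℓpos, hnorm]; exact_mod_cast hnℓ
        calc Real.log 2 / 3 * ‖x‖ / ℓ = Real.log 2 / 3 * (‖x‖ / ℓ) := by ring
          _ ≤ Real.log 2 / 3 * 1 := mul_le_mul_of_nonneg_left h1 (by positivity)
          _ ≤ 2 * Real.log 2 := by linarith
      have hexp := half_pow_le_four_mul_exp_neg hs
      rw [pow_zero] at hexp
      calc twoPointFree d β x ≤ C₀ * (1 / ‖x‖) ^ (d - 2) := hIR β hβ hβc x hx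
        _ = C₀ * (1 / ‖x‖) ^ (d - 2) * 1 := (mul_one _).symm
        _ ≤ C₀ * (1 / ‖x‖) ^ (d - 2) * (4 * Real.exp (-(Real.log 2 / 3 * ‖x‖ / ℓ))) :=
            mul_le_mul_of_nonneg_left hexp (mul_nonneg hC₀.le hP)
        _ = 4 * C₀ * (1 / ‖x‖) ^ (d - 2) * Real.exp (-(Real.log 2 / 3 * ‖x‖ / ℓ)) := by ring
    · -- `‖x‖ > ℓ`: `|x| ∧ L(β) = ℓ`, stopped iteration with `k = ⌊(n - ℓ)/(2ℓ+1)⌋` steps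
      push Not at hnℓ
      have hmin : min ‖x‖ (ℓ : ℝ) = ℓ := min_eq_right (by rw [hnorm]; exact_mod_cast hnℓ.le)
      rw [hmin]
      -- the a-priori (infrared) bound beyond radius `ℓ`
      have hB0 : 0 ≤ C₀ * (1 / (ℓ : ℝ)) ^ (d - 2) := by positivity
      have hB : ∀ z : Site d, ℓ ≤ Site.supNorm z →
          twoPointFree d β z ≤ C₀ * (1 / (ℓ : ℝ)) ^ (d - 2) := by
        intro z hz
        have hz0 : z ≠ 0 := fun h => by
          rw [h, Site.supNorm_eq_zero_iff.2 rfl] at hz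
          omega
        have hzn : (ℓ : ℝ) ≤ ‖z‖ := by rw [Site.norm_eq_supNorm]; exact_mod_cast hz
        calc twoPointFree d β z ≤ C₀ * (1 / ‖z‖) ^ (d - 2) := hIR β hβ hβc z hz0
          _ ≤ C₀ * (1 / (ℓ : ℝ)) ^ (d - 2) := by
              refine mul_le_mul_of_nonneg_left ?_ hC₀.le
              exact pow_le_pow_left₀ (by positivity)
                (one_div_le_one_div_of_le hℓpos hzn) _
      -- number of steps
      set k : ℕ := (n - ℓ) / (2 * ℓ + 1) with hk
      have hkn : k * (2 * ℓ + 1) + ℓ ≤ n := by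
        have h' : k * (2 * ℓ + 1) ≤ n - ℓ := Nat.div_mul_le_self (n - ℓ) (2 * ℓ + 1)
        omega
      have hmain := twoPointFree_le_dctIsingPhi_pow_mul hgks hmono hlim htr hβ h0S hSK hB k x hkn
      -- `n ≤ 3ℓ(k+2)`
      have hlt : n - ℓ < (2 * ℓ + 1) * (k + 1) := Nat.lt_mul_div_succ (n - ℓ) (by omega)
      have hn3 : n ≤ 3 * (ℓ * (k + 1)) + 3 * ℓ := by
        have e1 : (2 * ℓ + 1) * (k + 1) = 2 * (ℓ * (k + 1)) + (k + 1) := by ring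
        have e3 : k + 1 ≤ ℓ * (k + 1) := Nat.le_mul_of_pos_left _ hℓ1
        omega
      have hs : Real.log 2 / 3 * ‖x‖ / ℓ ≤ ((k : ℕ) + 2) * Real.log 2 := by
        have h1 : (n : ℝ) ≤ 3 * (ℓ * (k + 1)) + 3 * ℓ := by exact_mod_cast hn3
        have h2 : ‖x‖ / ℓ ≤ 3 * (k + 2) := by
          rw [div_le_iff₀ hℓpos, hnorm]
          nlinarith
        calc Real.log 2 / 3 * ‖x‖ / ℓ = Real.log 2 / 3 * (‖x‖ / ℓ) := by ring
          _ ≤ Real.log 2 / 3 * (3 * (k + 2)) := mul_le_mul_of_nonneg_left h2 (by positivity)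
          _ = ((k : ℕ) + 2) * Real.log 2 := by ring
      have hexp := half_pow_le_four_mul_exp_neg hs
      calc twoPointFree d β x ≤ dctIsingPhi d β S ^ k * (C₀ * (1 / (ℓ : ℝ)) ^ (d - 2)) := hmain
        _ ≤ (1 / 2 : ℝ) ^ k * (C₀ * (1 / (ℓ : ℝ)) ^ (d - 2)) :=
            mul_le_mul_of_nonneg_right (pow_le_pow_left₀ hφ0 hφ.le k) hB0
        _ ≤ 4 * Real.exp (-(Real.log 2 / 3 * ‖x‖ / ℓ)) * (C₀ * (1 / (ℓ : ℝ)) ^ (d - 2)) :=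
            mul_le_mul_of_nonneg_right hexp hB0
        _ = 4 * C₀ * (1 / (ℓ : ℝ)) ^ (d - 2) * Real.exp (-(Real.log 2 / 3 * ‖x‖ / ℓ)) := by
            ring

end Literature.Probability.LatticeModels
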